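import Summits.HubbardSuperconductivity.HubbardSuperconductivity.Theorems.FunctionFieldCertificateMesoscopicPairOrderSeedForms
import HarnessLib

/-!
# Crux `LeakBeatingBlockPairSeed` (piece (B) of the BC2 redirect of `MesoscopicPairOrder`, stmt-HubbardSuperconductivity-7331)
# — BIRTH SKELETON (planner cstrat-r1, 2026-08-17)

Piece (B) of the split `MesoscopicPairOrder ⇐ GoldstonePairProfile ∧ LeakBeatingBlockPairSeed` (assembly = the
landed `Theorems.FunctionFieldCertificate.mesoscopicPairOrderOfSubs`, p137259): at SOME `(U, δ)`, for every
background budget `(S, A)` ONE block scale `R₀ > 0`, a radius `ε > 0` and a margin `m₀` beating the leak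
`32ε(Sε+A) + (S + A/ε)/R₀²`, with the Fejér-box `d`-wave pair order `m₀ R₀² ≤ T_{R₀}(ψ)/L²` in every normalised
`(N_L, S^z = 0)`-sector ground state of every large even torus
(`T_R(ψ) = Σ_{x,y} Πᵢ (1 - |(y - x)ᵢ|_L/R)₊ Re⟨P_x ψ, P_y ψ⟩`, `P_x = localPair dWaveFormFactor L x`).
By the landed `leakBeatingBlockPairSeedIffSuperlinear` (p137448) it is EXACTLY super-linear block pair order
`∃ (U,δ) ∀ C ∃ R₀ > 0 … : C·R₀ ≤ T_{R₀}(ψ)/L²`.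

Two REGISTERED STUBS, cut along the two logically different ingredients of super-linear growth of the
scale function `R ↦ min_GS T_R/L²` — a POSITIVE START at every fixed scale (normal-state pair fluctuations)
and a PROPAGATION LAW across scales (the U(1)-breaking content, in scale-inductive form):

* `stub_pairFluctuationFloor` (Q) — on the box `U ∈ (0, 6]`, `δ ∈ [1/10, 3/10]` (the route's target window
  `[4,6]×[3/20,1/4]` plus the weak-coupling strip; clear of saturated ferromagnets by the landed
  `Negative/NoSaturationEnvelope`, p140748), EVERY fixed block scale `R ≥ 1` has a positive floor `c(U,δ,R) > 0`
  of `T_R(ψ)/L²`, uniformly over normalised sector ground states of all large even tori. A NORMAL-STATE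
  statement (no symmetry breaking: the free Fermi gas has `T_R/L² → ≈ 0.9·S_free(0) ≈ 2 > 0` at every `R`,
  calibration-free-gas.md of lead c2): it says no sector ground state in the box has vanishing `d`-wave pair
  fluctuations at small momenta `|q| ≲ 1/R`. OPEN (nothing identifies exact doped-Hubbard ground states), but
  of a different KIND from the parent: a floor that may decay in `R` as fast as it likes.
* `stub_coherenceDoubling` (D) — at SOME point of the same box there are `θ > 2` and `R₁` such that
  `θ · T_R(ψ) ≤ T_{2R}(ψ)` for ALL `R ≥ R₁`, in every normalised sector ground state of every large even torus:
  pair coherence PROPAGATES from scale `R` to scale `2R` with a super-linear factor (`θ ≤ 4` always, by the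
  landed `boxSum_mul_le_sq_mul_boxSum`, `T_{2R} ≤ 4T_R`; `θ → 4` under LRO once `R ≫ √(S/2a)`; `θ → 1` in a
  normal metal; `θ = 2^{2-η}` under algebraic quasi-order `|x|^{-η}`). This is the U(1)-breaking content of
  (B) in SCALE-INDUCTIVE form (strengthen-to-induct): one affine inequality between the SAME functional at two
  consecutive dyadic scales, the shape a multiscale / block-spin argument proves step by step. OPEN, no engine.

Composition `LeakBeatingBlockPairSeed_of` (sorry-free below): at (D)'s point take `R := max R₁ 1`, the floor
`c > 0` of (Q) at scale `R`, iterate (D) `k` times — `θ^k c ≤ T_{2^k R}(ψ)/L²` eventually in `L`, uniformly in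
GS (induction on `k`) — and since `θ/2 > 1`, `(θ/2)^k` beats any `C·R/c`: super-linear block pair order, hence
(B) by `leakBeatingBlockPairSeedIffSuperlinear.mpr`. Neither stub alone gives (B): (Q)'s floors may decay like
`S/R²` (normal metal; then (B) is false, cf. `Negative/FlatStructureFactor` at `U = 0`), and (D) holds
vacuously-in-content for ground states with `T_R ≡ 0` (saturated ferromagnets, Disproof §2), where (B) fails.
Neither is the parent or the summit reworded: (Q) is implied by neither (it is ∀ on a box), (D) is an
inter-scale RATE that `MesoscopicPairOrder` alone does not give (it needs the upper profile (A) as well).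

Sources: Kennedy–Lieb–Shastry, PRL 61 (1988) 2582 (block / Parseval accounting of order operators);
Dyson–Lieb–Simon, J. Stat. Phys. 18 (1978) 335 (infrared bounds ⇒ LRO, the role of a positive floor);
Fröhlich–Simon–Spencer, CMP 50 (1976) 79; J. Fröhlich, T. Spencer, CMP 81 (1981) 527 (scale-by-scale
propagation of coherence — the shape of (D)); Stein–Shakarchi, *Fourier Analysis*, Ch. 2 (Fejér kernels).
No definition enters a registered signature (the `boxT` shorthand below is proof-internal); nothing here
claims (Q), (D) or (B).
-/

noncomputable section

-- the summit namespace repeats the problem name by design (D-0017)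
set_option linter.dupNamespace false

namespace Summit.HubbardSuperconductivity.HubbardSuperconductivity.Cruxes.LeakBeatingBlockPairSeed.Birth

open Matrix Finset Filter
open Literature.Probability.LatticeModels Literature.MathematicalPhysics.QuantumLattice
open Summit.HubbardSuperconductivity.HubbardSuperconductivity.Theses.FunctionFieldCertificate
open Summit.HubbardSuperconductivity.HubbardSuperconductivity.Theorems.FunctionFieldCertificate
open scoped ComplexOrder ComplexConjugate

/-- DRAFT-LOCAL copy of piece (B) (verbatim the child statement; replaced by the route decl
`Theses.FunctionFieldCertificate.LeakBeatingBlockPairSeed` once the split is filed). -/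
def LeakBeatingBlockPairSeed : Prop :=
  ∃ U : ℝ, 0 < U ∧ ∃ δ ∈ Set.Ioo (0:ℝ) (1 / 2), ∀ S A : ℝ, 0 ≤ S → 0 ≤ A → ∃ (R₀ : ℕ) (ε m₀ : ℝ), 0 < R₀ ∧ 0 < ε ∧ 32 * ε * (S * ε + A) + (S + A / ε) / (R₀ : ℝ) ^ 2 < m₀ ∧ ∃ L₀ : ℕ, ∀ (L : ℕ) [NeZero L], L₀ ≤ L → Even L → ∀ ψ : Literature.MathematicalPhysics.QuantumLattice.Fock (Literature.MathematicalPhysics.QuantumLattice.Orb (Literature.MathematicalPhysics.QuantumLattice.FermionTorus 2 L)), star ψ ⬝ᵥ ψ = 1 → Literature.MathematicalPhysics.QuantumLattice.IsGroundStateInSector (Literature.MathematicalPhysics.QuantumLattice.hubbardTorus 2 L 1 U) (2 * ⌊(1 - δ) * (L : ℝ) ^ 2 / 2⌋₊) 0 ψ → m₀ * (R₀ : ℝ) ^ 2 ≤ (∑ x : Fin 2 → ZMod L, ∑ y : Fin 2 → ZMod L, (∏ i : Fin 2, max 0 (1 - |(((y i - x i).valMinAbs : ℤ) : ℝ)| /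 (R₀ : ℝ))) * (star (Matrix.mulVec (Literature.MathematicalPhysics.QuantumLattice.localPair Literature.MathematicalPhysics.QuantumLattice.dWaveFormFactor L x) ψ) ⬝ᵥ Matrix.mulVec (Literature.MathematicalPhysics.QuantumLattice.localPair Literature.MathematicalPhysics.QuantumLattice.dWaveFormFactor L y) ψ).re) / (L : ℝ) ^ 2

/-! ### The two stubs -/

/-- **Stub (Q) `stub_pairFluctuationFloor`** — PAIR-FLUCTUATION FLOOR AT EVERY FIXED SCALE, on the box
`U ∈ (0,6]`, `δ ∈ [1/10, 3/10]`: for every block scale `R ≥ 1` there are `c > 0` and `L₀` such that every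
normalised `(N_L,0)`-sector ground state `ψ` of `hubbardTorus 2 L 1 U` on every even torus `L ≥ L₀` has
`c ≤ T_R(ψ)/L²`. The floor may depend on `(U, δ, R)` in any way (a normal metal has `≈ 0.9 S(0)`, decaying
share `∼ S/R²` of the block area): this is positivity of the small-momentum `d`-wave pair fluctuations in every
ground state, NOT order. Why it might fail: a sector GS in the box whose pair structure factor vanishes near
`q = 0` along `L → ∞` (partially polarised ferromagnet — only SATURATION is excluded on the box, p140748, and
`PolarisedCeiling` p143939 shows near-saturation drives `T_R` to `0`; phase separation; an `η`-paired corner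
state). OPEN. -/
theorem stub_pairFluctuationFloor :
    ∀ U : ℝ, U ∈ Set.Ioc (0:ℝ) 6 → ∀ δ : ℝ, δ ∈ Set.Icc (1 / 10 : ℝ) (3 / 10) → ∀ R : ℕ, 0 < R →
      ∃ c : ℝ, 0 < c ∧ ∃ L₀ : ℕ, ∀ (L : ℕ) [NeZero L], L₀ ≤ L → Even L →
        ∀ ψ : Fock (Orb (FermionTorus 2 L)), star ψ ⬝ᵥ ψ = 1 →
          IsGroundStateInSector (hubbardTorus 2 L 1 U) (2 * ⌊(1 - δ) * (L : ℝ) ^ 2 / 2⌋₊) 0 ψ →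
            c ≤ (∑ x : TorusSite 2 L, ∑ y : TorusSite 2 L,
              (∏ i : Fin 2, max 0 (1 - |(((y i - x i).valMinAbs : ℤ) : ℝ)| / (R : ℝ))) *
                (star (localPair dWaveFormFactor L x *ᵥ ψ) ⬝ᵥ (localPair dWaveFormFactor L y *ᵥ ψ)).re) /
              (L : ℝ) ^ 2 := by
  sorry

/-- **Stub (D) `stub_coherenceDoubling`** (LOAD-BEARING) — SCALE-DOUBLING PROPAGATION OF PAIR COHERENCE at
SOME point of the box `U ∈ (0,6]`, `δ ∈ [1/10, 3/10]`: there are `θ > 2` and `R₁` such that for every block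
scale `R ≥ R₁`, eventually in even `L`, every normalised `(N_L,0)`-sector ground state has
`θ · T_R(ψ) ≤ T_{2R}(ψ)`. (`θ ≤ 4` is forced by `T_{2R} ≤ 4 T_R`, `boxSum_mul_le_sq_mul_boxSum` p140875;
`θ > 2` means the block pair order per unit LENGTH strictly grows along the dyadic scales, i.e. pair
(quasi-)order with exponent `η = 2 - log₂ θ < 1`.) Why it might fail: it is false at every point without
pair (quasi-)order (normal metal: `T_{2R}/T_R → 1`), and at an ordered point it needs `R₁ ≳ √(S/2a) ≈ 30–100`
(flat background `S ≈ 2.2`, condensate `a ≈ 10⁻³`) — a uniform-in-GS inter-scale inequality for exact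
doped-Hubbard ground states, for which no multiscale engine exists (no RP, constructive RG stops above the BCS
scale). OPEN, no engine; it is the statement a block-spin / scale-induction argument would prove. -/
theorem stub_coherenceDoubling :
    ∃ U : ℝ, U ∈ Set.Ioc (0:ℝ) 6 ∧ ∃ δ : ℝ, δ ∈ Set.Icc (1 / 10 : ℝ) (3 / 10) ∧ ∃ θ : ℝ, 2 < θ ∧ ∃ R₁ : ℕ,
      ∀ R : ℕ, R₁ ≤ R → ∃ L₀ : ℕ, ∀ (L : ℕ) [NeZero L], L₀ ≤ L → Even L →
        ∀ ψ : Fock (Orb (FermionTorus 2 L)), star ψ ⬝ᵥ ψ = 1 →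
          IsGroundStateInSector (hubbardTorus 2 L 1 U) (2 * ⌊(1 - δ) * (L : ℝ) ^ 2 / 2⌋₊) 0 ψ →
            θ * (∑ x : TorusSite 2 L, ∑ y : TorusSite 2 L,
              (∏ i : Fin 2, max 0 (1 - |(((y i - x i).valMinAbs : ℤ) : ℝ)| / (R : ℝ))) *
                (star (localPair dWaveFormFactor L x *ᵥ ψ) ⬝ᵥ (localPair dWaveFormFactor L y *ᵥ ψ)).re) ≤
            (∑ x : TorusSite 2 L, ∑ y : TorusSite 2 L,
              (∏ i : Fin 2, max 0 (1 - |(((y i - x i).valMinAbs : ℤ) : ℝ)| / ((2 * R : ℕ) : ℝ))) *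
                (star (localPair dWaveFormFactor L x *ᵥ ψ) ⬝ᵥ (localPair dWaveFormFactor L y *ᵥ ψ)).re) := by
  sorry

/-! ### Composition: (Q) → (D) → super-linear block pair order → (B) -/

/-- Proof-internal shorthand for the Fejér-box pair functional `T_R(ψ)` (enters no registered signature). -/
def boxT (L : ℕ) [NeZero L] (R : ℕ) (ψ : Fock (Orb (FermionTorus 2 L))) : ℝ :=
  ∑ x : TorusSite 2 L, ∑ y : TorusSite 2 L,
    (∏ i : Fin 2, max 0 (1 - |(((y i - x i).valMinAbs : ℤ) : ℝ)| / (R : ℝ))) *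
      (star (localPair dWaveFormFactor L x *ᵥ ψ) ⬝ᵥ (localPair dWaveFormFactor L y *ᵥ ψ)).re

/-- **Iterated doubling from a positive floor** (the induction on scales): if at `(U, δ)` scale `R` has the
floor `c` (eventually, every GS) and the doubling law `θ·T_{R'} ≤ T_{2R'}` holds for all `R' ≥ R₁` with
`R₁ ≤ R`, then `θ^k c ≤ T_{2^k R}(ψ)/L²` eventually in `L`, for every `k`. [folklore] -/
theorem iterate_doubling {U δ θ c : ℝ} {R R₁ : ℕ} (hθ : 0 ≤ θ) (hR₁ : R₁ ≤ R)
    (hQ : ∃ L₀ : ℕ, ∀ (L : ℕ) [NeZero L], L₀ ≤ L → Even L →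
      ∀ ψ : Fock (Orb (FermionTorus 2 L)), star ψ ⬝ᵥ ψ = 1 →
        IsGroundStateInSector (hubbardTorus 2 L 1 U) (2 * ⌊(1 - δ) * (L : ℝ) ^ 2 / 2⌋₊) 0 ψ →
          c ≤ boxT L R ψ / (L : ℝ) ^ 2)
    (hD : ∀ R' : ℕ, R₁ ≤ R' → ∃ L₀ : ℕ, ∀ (L : ℕ) [NeZero L], L₀ ≤ L → Even L →
      ∀ ψ : Fock (Orb (FermionTorus 2 L)), star ψ ⬝ᵥ ψ = 1 →
        IsGroundStateInSector (hubbardTorus 2 L 1 U) (2 * ⌊(1 - δ) * (L : ℝ) ^ 2 / 2⌋₊) 0 ψ →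
          θ * boxT L R' ψ ≤ boxT L (2 * R') ψ) :
    ∀ k : ℕ, ∃ L₀ : ℕ, ∀ (L : ℕ) [NeZero L], L₀ ≤ L → Even L →
      ∀ ψ : Fock (Orb (FermionTorus 2 L)), star ψ ⬝ᵥ ψ = 1 →
        IsGroundStateInSector (hubbardTorus 2 L 1 U) (2 * ⌊(1 - δ) * (L : ℝ) ^ 2 / 2⌋₊) 0 ψ →
          θ ^ k * c ≤ boxT L (2 ^ k * R) ψ / (L : ℝ) ^ 2 := by
  intro k
  induction k with
  | zero =>
      obtain ⟨L₀, h⟩ := hQ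
      refine ⟨L₀, fun L _ hL hE ψ hψ hgs => ?_⟩
      simpa only [pow_zero, one_mul] using h L hL hE ψ hψ hgs
  | succ k ih =>
      obtain ⟨L₁, h₁⟩ := ih
      have hscale : R₁ ≤ 2 ^ k * R := le_trans hR₁ (Nat.le_mul_of_pos_left R (Nat.two_pow_pos k))
      obtain ⟨L₂, h₂⟩ := hD (2 ^ k * R) hscale
      refine ⟨max L₁ L₂, fun L _ hL hE ψ hψ hgs => ?_⟩
      have a := h₁ L (le_of_max_le_left hL) hE ψ hψ hgs
      have b := h₂ L (le_of_max_le_right hL) hE ψ hψ hgs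
      have hLpos : (0 : ℝ) < L := Nat.cast_pos.2 (Nat.pos_of_ne_zero (NeZero.ne L))
      have hL2 : (0 : ℝ) < (L : ℝ) ^ 2 := by positivity
      have e : 2 ^ (k + 1) * R = 2 * (2 ^ k * R) := by ring
      rw [e]
      calc θ ^ (k + 1) * c = θ * (θ ^ k * c) := by ring
        _ ≤ θ * (boxT L (2 ^ k * R) ψ / (L : ℝ) ^ 2) := mul_le_mul_of_nonneg_left a hθ
        _ = θ * boxT L (2 ^ k * R) ψ / (L : ℝ) ^ 2 := by ring
        _ ≤ boxT L (2 * (2 ^ k * R)) ψ / (L : ℝ) ^ 2 := div_le_div_of_nonneg_right b hL2.le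

/-- **Super-linear block pair order from (Q) and (D)** (the RHS of `leakBeatingBlockPairSeedIffSuperlinear`). -/
theorem superlinear_of_stubs :
    ∃ U : ℝ, 0 < U ∧ ∃ δ ∈ Set.Ioo (0:ℝ) (1 / 2), ∀ C : ℝ, ∃ R₀ : ℕ, 0 < R₀ ∧ ∃ L₀ : ℕ,
      ∀ (L : ℕ) [NeZero L], L₀ ≤ L → Even L → ∀ ψ : Fock (Orb (FermionTorus 2 L)), star ψ ⬝ᵥ ψ = 1 →
        IsGroundStateInSector (hubbardTorus 2 L 1 U) (2 * ⌊(1 - δ) * (L : ℝ) ^ 2 / 2⌋₊) 0 ψ →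
          C * (R₀ : ℝ) ≤ (∑ x : TorusSite 2 L, ∑ y : TorusSite 2 L,
            (∏ i : Fin 2, max 0 (1 - |(((y i - x i).valMinAbs : ℤ) : ℝ)| / (R₀ : ℝ))) *
              (star (localPair dWaveFormFactor L x *ᵥ ψ) ⬝ᵥ (localPair dWaveFormFactor L y *ᵥ ψ)).re) /
            (L : ℝ) ^ 2 := by
  obtain ⟨U, hU, δ, hδ, θ, hθ, R₁, hD⟩ := stub_coherenceDoubling
  have hUpos : 0 < U := hU.1
  have hδ' : δ ∈ Set.Ioo (0:ℝ) (1 / 2) := ⟨by linarith [hδ.1], by linarith [hδ.2]⟩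
  refine ⟨U, hUpos, δ, hδ', fun C => ?_⟩
  -- the base scale and its floor
  set R : ℕ := max R₁ 1 with hRdef
  have hRpos : 0 < R := lt_of_lt_of_le Nat.one_pos (le_max_right _ _)
  have hR₁R : R₁ ≤ R := le_max_left _ _
  obtain ⟨c, hc, L_Q, hQ⟩ := stub_pairFluctuationFloor U hU δ hδ R hRpos
  -- the iterated doubling bound
  have hiter := iterate_doubling (U := U) (δ := δ) (by linarith : (0:ℝ) ≤ θ) hR₁R ⟨L_Q, hQ⟩
    (fun R' hR' => hD R' hR')
  -- choose the number of doublings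
  have hθ2 : 1 < θ / 2 := by linarith
  obtain ⟨k, hk⟩ := pow_unbounded_of_one_lt (max C 0 * (R : ℝ) / c) hθ2
  obtain ⟨L₀, hL₀⟩ := hiter k
  refine ⟨2 ^ k * R, by positivity, L₀, fun L _ hL hE ψ hψ hgs => ?_⟩
  have h := hL₀ L hL hE ψ hψ hgs
  have hRreal : (0 : ℝ) < (R : ℝ) := Nat.cast_pos.2 hRpos
  have h2k : (0 : ℝ) < (2 : ℝ) ^ k := by positivity
  have hkey : C * ((2 ^ k * R : ℕ) : ℝ) ≤ θ ^ k * c := by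
    push_cast
    have h1 : C * (2 ^ k * (R : ℝ)) ≤ max C 0 * (2 ^ k * (R : ℝ)) :=
      mul_le_mul_of_nonneg_right (le_max_left _ _) (by positivity)
    have h2 : max C 0 * (R : ℝ) / c * c = max C 0 * (R : ℝ) := by field_simp
    have h3 : max C 0 * (2 ^ k * (R : ℝ)) = (max C 0 * (R : ℝ) / c) * c * 2 ^ k := by
      rw [h2]; ring
    have h4 : (max C 0 * (R : ℝ) / c) * c * 2 ^ k ≤ (θ / 2) ^ k * c * 2 ^ k := by
      have := hk.le
      gcongr
    have h5 : (θ / 2) ^ k * c * 2 ^ k = θ ^ k * c := by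
      rw [div_pow]
      field_simp
    linarith [h1, h3, h4, h5]
  exact hkey.trans h

/-- **The skeleton closes piece (B) modulo its two stubs**: `LeakBeatingBlockPairSeed` from
`stub_pairFluctuationFloor` (Q) and `stub_coherenceDoubling` (D), through `superlinear_of_stubs` and the
landed `leakBeatingBlockPairSeedIffSuperlinear` (p137448). [folklore] -/
theorem LeakBeatingBlockPairSeed_of : LeakBeatingBlockPairSeed :=
  leakBeatingBlockPairSeedIffSuperlinear.mpr superlinear_of_stubs

end Summit.HubbardSuperconductivity.HubbardSuperconductivity.Cruxes.LeakBeatingBlockPairSeed.Birth
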